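import Summits.AnomalousDissipation.AnomalousDissipation.Theorems.SolenoidalFractalHomogenisationLagrangianStepCellLawVOddGainDefectPairing
import HarnessLib

/-!
# K1L `LagrangianRenormalisationStep(Design)` (K1L_D, stmt-AnomalousDissipation-27980; aside 24912), stub `stub_cellLawV0_IS`
# — exact sector NON-expansion of the slot response, part 2: the forward/backward DUHAMEL solutions of `u' = ∓Cu ± ψ·v` in closed form
# (helper; `--supports stmt-AnomalousDissipation-27980`; word-independent)

Summits-side helper file of route `SolenoidalFractalHomogenisation` (prover seat `ad-k1l-cellLawV-w1` g2), companion of `…CellLawVGreenPairing`: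
the concrete Duhamel solutions that feed `green_swap` / `green_energy`, for a matrix `C`, a continuous envelope `ψ` and a vector `v`
(no definitions — the solutions are written out as `e^{∓sC}·(∫ ψ(r)(e^{±rC}v)_k dr)_k`):
* §12 matrix-exponential bookkeeping: `e^{−sC}e^{rC} = e^{−(s−r)C}`, `e^{sC}e^{−rC} = e^{−(r−s)C}`, entrywise derivatives of `s ↦ e^{∓sC}`
  (from ad-lit's `hasDerivAt_exp_neg_smul_mulVec`, p635350), `integral_sum_sum_const_mul`;
* §13 **forward**: `hasDerivAt_duhamelFwd` (`u⁺' = −Cu⁺ + ψ(s)v`), `duhamelFwd_zero`, `dotProduct_duhamelFwd` (`y·u⁺(s) = ∫₀ˢψ(r)·(y·e^{−(s−r)C}v)dr`);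
* §14 **backward**: `hasDerivAt_duhamelBwd` (`u⁻' = Cu⁻ − ψ(s)v`), `duhamelBwd_one`, `dotProduct_duhamelBwd` (`y·u⁻(s) = ∫ₛ¹ψ(r)·(y·e^{−(r−s)C}v)dr`);
  `dotProduct_exp_neg_smul_mulVec_transpose` (`y·e^{−tC}v = v·e^{−tCᵀ}y`, `Matrix.exp_transpose`).
Everything PROVED, no definition, no named fact, no sorry.  Infrastructure for route-1's rung leaf F-D1.A0 (frontier FORMAL rung); NOT a proof of the
stub, of the crux, of Onsager's conjecture or of anomalous dissipation.  Prover seat `ad-k1l-cellLawV-w1` g2, 2026-08-28.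
-/

set_option linter.dupNamespace false

noncomputable section

namespace Summit.AnomalousDissipation.AnomalousDissipation.Theorems.SolenoidalFractalHomogenisation.LagrangianStep.OddGain

open Matrix Finset MeasureTheory Set
open Literature.Analysis.ODE.PeriodicAveraging

/-! ## §12 Matrix-exponential bookkeeping -/

section ExpAlgebra

/-- `e^{−sC}e^{rC} = e^{−(s−r)C}`. [folklore] -/
theorem exp_neg_smul_mul_exp_smul (C : Matrix (Fin 3) (Fin 3) ℝ) (s r : ℝ) :
    NormedSpace.exp (-(s • C)) * NormedSpace.exp (r • C) = NormedSpace.exp (-((s - r) • C)) := by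
  have hc : Commute (-(s • C)) (r • C) := (((Commute.refl C).smul_right r).smul_left s).neg_left
  rw [← Matrix.exp_add_of_commute _ _ hc]
  congr 1
  rw [sub_smul]; abel

/-- `e^{sC}e^{−rC} = e^{−(r−s)C}`. [folklore] -/
theorem exp_smul_mul_exp_neg_smul (C : Matrix (Fin 3) (Fin 3) ℝ) (s r : ℝ) :
    NormedSpace.exp (s • C) * NormedSpace.exp (-(r • C)) = NormedSpace.exp (-((r - s) • C)) := by
  have hc : Commute (s • C) (-(r • C)) := (((Commute.refl C).smul_right r).smul_left s).neg_right
  rw [← Matrix.exp_add_of_commute _ _ hc]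
  congr 1
  rw [sub_smul]; abel

/-- `e^{−sC}e^{sC} = 1`. [folklore] -/
theorem exp_neg_smul_mul_exp_smul_self (C : Matrix (Fin 3) (Fin 3) ℝ) (s : ℝ) :
    NormedSpace.exp (-(s • C)) * NormedSpace.exp (s • C) = 1 := by
  rw [exp_neg_smul_mul_exp_smul, sub_self, zero_smul, neg_zero, NormedSpace.exp_zero]

/-- `e^{sC}e^{−sC} = 1`. [folklore] -/
theorem exp_smul_mul_exp_neg_smul_self (C : Matrix (Fin 3) (Fin 3) ℝ) (s : ℝ) :
    NormedSpace.exp (s • C) * NormedSpace.exp (-(s • C)) = 1 := by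
  rw [exp_smul_mul_exp_neg_smul, sub_self, zero_smul, neg_zero, NormedSpace.exp_zero]

/-- `(M e_k)_i = M_{ik}`. -/
theorem mulVec_single_one_apply (M : Matrix (Fin 3) (Fin 3) ℝ) (i k : Fin 3) : (M *ᵥ Pi.single k 1) i = M i k := by
  rw [Matrix.mulVec_single_one]; rfl

/-- Entrywise derivative of `s ↦ e^{−sC}`: `d/ds (e^{−sC})_{ik} = −(C e^{−sC})_{ik}`. [folklore] -/
theorem hasDerivAt_exp_neg_smul_entry (C : Matrix (Fin 3) (Fin 3) ℝ) (i k : Fin 3) (s : ℝ) :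
    HasDerivAt (fun s : ℝ => (NormedSpace.exp (-(s • C))) i k) (-((C * NormedSpace.exp (-(s • C))) i k)) s := by
  have h := hasDerivAt_exp_neg_smul_mulVec C (Pi.single k 1) s
  rw [hasDerivAt_pi] at h
  have hi := h i
  simp only [Matrix.mulVec_mulVec, mulVec_single_one_apply, Pi.neg_apply] at hi
  exact hi

/-- Entrywise derivative of `s ↦ e^{sC}`: `d/ds (e^{sC})_{ik} = (C e^{sC})_{ik}`. [folklore] -/
theorem hasDerivAt_exp_smul_entry (C : Matrix (Fin 3) (Fin 3) ℝ) (i k : Fin 3) (s : ℝ) :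
    HasDerivAt (fun s : ℝ => (NormedSpace.exp (s • C)) i k) ((C * NormedSpace.exp (s • C)) i k) s := by
  have h := hasDerivAt_exp_neg_smul_entry (-C) i k s
  simp only [smul_neg, neg_neg, neg_mul, Matrix.neg_apply] at h
  exact h

/-- Finite double sums with constant coefficients commute with the interval integral. [folklore] -/
theorem integral_sum_sum_const_mul {f : Fin 3 → ℝ → ℝ} (hf : ∀ k, Continuous (f k)) (c : Fin 3 → Fin 3 → ℝ) (a b : ℝ) :
    ∫ x in a..b, ∑ i, ∑ k, c i k * f k x = ∑ i, ∑ k, c i k * ∫ x in a..b, f k x := by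
  have hik : ∀ i k, IntervalIntegrable (fun x => c i k * f k x) volume a b := fun i k =>
    ((hf k).const_mul _).intervalIntegrable _ _
  have hi : ∀ i, IntervalIntegrable (fun x => ∑ k, c i k * f k x) volume a b := by
    intro i
    have h := IntervalIntegrable.sum Finset.univ fun k (_ : k ∈ Finset.univ) => hik i k
    rw [Finset.sum_fn] at h
    exact h
  rw [intervalIntegral.integral_finsetSum fun i _ => hi i]
  refine Finset.sum_congr rfl fun i _ => ?_
  rw [intervalIntegral.integral_finsetSum fun k _ => hik i k]
  exact Finset.sum_congr rfl fun k _ => intervalIntegral.integral_const_mul _ _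

/-- The orbit `r ↦ e^{rC} v` is continuous. [folklore] -/
theorem continuous_exp_smul_mulVec (C : Matrix (Fin 3) (Fin 3) ℝ) (v : Fin 3 → ℝ) :
    Continuous fun r : ℝ => (NormedSpace.exp (r • C)) *ᵥ v := by
  have h := continuous_exp_neg_smul_mulVec (-C) v
  simp only [smul_neg, neg_neg] at h
  exact h

end ExpAlgebra

/-! ## §13 The forward Duhamel solution `u⁺(s) = ∫₀ˢ e^{−(s−r)C}ψ(r)v dr` -/

section Forward

/-- **Forward Duhamel solution: the ODE** `u⁺' = −C u⁺ + ψ(s)·v` for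
`u⁺(s) = e^{−sC}·(∫₀ˢ ψ(r)(e^{rC}v)_k dr)_k`. [folklore] -/
theorem hasDerivAt_duhamelFwd (C : Matrix (Fin 3) (Fin 3) ℝ) {ψ : ℝ → ℝ} (hψ : Continuous ψ) (v : Fin 3 → ℝ) (s : ℝ) :
    HasDerivAt (fun s : ℝ => (NormedSpace.exp (-(s • C))) *ᵥ fun k => ∫ r in (0:ℝ)..s, ψ r * ((NormedSpace.exp (r • C)) *ᵥ v) k)
      (-(C *ᵥ ((NormedSpace.exp (-(s • C))) *ᵥ fun k => ∫ r in (0:ℝ)..s, ψ r * ((NormedSpace.exp (r • C)) *ᵥ v) k)) + ψ s • v) s := by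
  have hW : ∀ k, HasDerivAt (fun s : ℝ => ∫ r in (0:ℝ)..s, ψ r * ((NormedSpace.exp (r • C)) *ᵥ v) k)
      (ψ s * ((NormedSpace.exp (s • C)) *ᵥ v) k) s := fun k =>
    ((hψ.mul ((continuous_apply k).comp (continuous_exp_smul_mulVec C v))).integral_hasStrictDerivAt 0 s).hasDerivAt
  rw [hasDerivAt_pi]
  intro i
  show HasDerivAt (fun s : ℝ => ∑ k, (NormedSpace.exp (-(s • C))) i k * ∫ r in (0:ℝ)..s, ψ r * ((NormedSpace.exp (r • C)) *ᵥ v) k) _ s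
  have h := HasDerivAt.fun_sum (u := Finset.univ) fun k _ => (hasDerivAt_exp_neg_smul_entry C i k s).mul (hW k)
  refine h.congr_deriv ?_
  -- the value of the derivative
  have hv : v i = ∑ k, (NormedSpace.exp (-(s • C))) i k * ((NormedSpace.exp (s • C)) *ᵥ v) k := by
    have h1 : v = (NormedSpace.exp (-(s • C))) *ᵥ ((NormedSpace.exp (s • C)) *ᵥ v) := by
      rw [Matrix.mulVec_mulVec, exp_neg_smul_mul_exp_smul_self, Matrix.one_mulVec]
    conv_lhs => rw [h1]
    rfl
  rw [Finset.sum_add_distrib, Pi.add_apply, Pi.neg_apply, Pi.smul_apply, smul_eq_mul, hv, Finset.mul_sum, Matrix.mulVec_mulVec]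
  congr 1
  · show ∑ k, -((C * NormedSpace.exp (-(s • C))) i k) * (∫ r in (0:ℝ)..s, ψ r * ((NormedSpace.exp (r • C)) *ᵥ v) k) =
      -(((C * NormedSpace.exp (-(s • C))) *ᵥ fun k => ∫ r in (0:ℝ)..s, ψ r * ((NormedSpace.exp (r • C)) *ᵥ v) k) i)
    simp only [Matrix.mulVec, dotProduct, neg_mul, Finset.sum_neg_distrib]
  · exact Finset.sum_congr rfl fun k _ => by ring

/-- Forward Duhamel solution: `u⁺(0) = 0`. -/
theorem duhamelFwd_zero (C : Matrix (Fin 3) (Fin 3) ℝ) (ψ : ℝ → ℝ) (v : Fin 3 → ℝ) :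
    ((NormedSpace.exp (-((0:ℝ) • C))) *ᵥ fun k => ∫ r in (0:ℝ)..0, ψ r * ((NormedSpace.exp (r • C)) *ᵥ v) k) = 0 := by
  have : (fun k => ∫ r in (0:ℝ)..0, ψ r * ((NormedSpace.exp (r • C)) *ᵥ v) k) = 0 := by
    funext k; simp
  rw [this, Matrix.mulVec_zero]

/-- **Forward Duhamel solution: the kernel form of its pairings** `y·u⁺(s) = ∫₀ˢ ψ(r)·(y·e^{−(s−r)C}v) dr`. [folklore] -/
theorem dotProduct_duhamelFwd (C : Matrix (Fin 3) (Fin 3) ℝ) {ψ : ℝ → ℝ} (hψ : Continuous ψ) (v y : Fin 3 → ℝ) (s : ℝ) :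
    y ⬝ᵥ ((NormedSpace.exp (-(s • C))) *ᵥ fun k => ∫ r in (0:ℝ)..s, ψ r * ((NormedSpace.exp (r • C)) *ᵥ v) k) =
      ∫ r in (0:ℝ)..s, ψ r * (y ⬝ᵥ ((NormedSpace.exp (-((s - r) • C))) *ᵥ v)) := by
  have hcont : ∀ k, Continuous fun r : ℝ => ψ r * ((NormedSpace.exp (r • C)) *ᵥ v) k := fun k =>
    hψ.mul ((continuous_apply k).comp (continuous_exp_smul_mulVec C v))
  -- kernel side, pointwise in `r`
  have hker : ∀ r : ℝ, ψ r * (y ⬝ᵥ ((NormedSpace.exp (-((s - r) • C))) *ᵥ v)) =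
      ∑ i, ∑ k, (y i * (NormedSpace.exp (-(s • C))) i k) * (ψ r * ((NormedSpace.exp (r • C)) *ᵥ v) k) := by
    intro r
    rw [← exp_neg_smul_mul_exp_smul C s r, ← Matrix.mulVec_mulVec]
    simp only [dotProduct, Matrix.mulVec, Finset.mul_sum]
    refine Finset.sum_congr rfl fun i _ => Finset.sum_congr rfl fun k _ => Finset.sum_congr rfl fun x _ => ?_
    ring
  simp_rw [hker]
  rw [integral_sum_sum_const_mul hcont]
  simp only [dotProduct, Matrix.mulVec, Finset.mul_sum]
  refine Finset.sum_congr rfl fun i _ => Finset.sum_congr rfl fun k _ => ?_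
  ring

end Forward

/-! ## §14 The backward Duhamel solution `u⁻(s) = ∫ₛ¹ e^{−(r−s)C}ψ(r)v dr` and the transposed pairing -/

section Backward

/-- **Backward Duhamel solution: the ODE** `u⁻' = C u⁻ − ψ(s)·v` for `u⁻(s) = e^{sC}·(∫ₛ¹ ψ(r)(e^{−rC}v)_k dr)_k`. [folklore] -/
theorem hasDerivAt_duhamelBwd (C : Matrix (Fin 3) (Fin 3) ℝ) {ψ : ℝ → ℝ} (hψ : Continuous ψ) (v : Fin 3 → ℝ) (s : ℝ) :
    HasDerivAt (fun s : ℝ => (NormedSpace.exp (s • C)) *ᵥ fun k => ∫ r in s..(1:ℝ), ψ r * ((NormedSpace.exp (-(r • C))) *ᵥ v) k)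
      (C *ᵥ ((NormedSpace.exp (s • C)) *ᵥ fun k => ∫ r in s..(1:ℝ), ψ r * ((NormedSpace.exp (-(r • C))) *ᵥ v) k) - ψ s • v) s := by
  have hg : ∀ k, Continuous fun r : ℝ => ψ r * ((NormedSpace.exp (-(r • C))) *ᵥ v) k := fun k =>
    hψ.mul ((continuous_apply k).comp (continuous_exp_neg_smul_mulVec C v))
  have hW : ∀ k, HasDerivAt (fun s : ℝ => ∫ r in s..(1:ℝ), ψ r * ((NormedSpace.exp (-(r • C))) *ᵥ v) k)
      (-(ψ s * ((NormedSpace.exp (-(s • C))) *ᵥ v) k)) s := by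
    intro k
    have h := ((hg k).integral_hasStrictDerivAt 1 s).hasDerivAt.neg
    have hf : (fun s : ℝ => ∫ r in s..(1:ℝ), ψ r * ((NormedSpace.exp (-(r • C))) *ᵥ v) k) =
        fun s => -∫ r in (1:ℝ)..s, ψ r * ((NormedSpace.exp (-(r • C))) *ᵥ v) k := by
      funext s; rw [intervalIntegral.integral_symm]
    rw [hf]
    exact h
  rw [hasDerivAt_pi]
  intro i
  show HasDerivAt (fun s : ℝ => ∑ k, (NormedSpace.exp (s • C)) i k * ∫ r in s..(1:ℝ), ψ r * ((NormedSpace.exp (-(r • C))) *ᵥ v) k) _ s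
  have h := HasDerivAt.fun_sum (u := Finset.univ) fun k _ => (hasDerivAt_exp_smul_entry C i k s).mul (hW k)
  refine h.congr_deriv ?_
  have hv : v i = ∑ k, (NormedSpace.exp (s • C)) i k * ((NormedSpace.exp (-(s • C))) *ᵥ v) k := by
    have h1 : v = (NormedSpace.exp (s • C)) *ᵥ ((NormedSpace.exp (-(s • C))) *ᵥ v) := by
      rw [Matrix.mulVec_mulVec, exp_smul_mul_exp_neg_smul_self, Matrix.one_mulVec]
    conv_lhs => rw [h1]
    rfl
  rw [Finset.sum_add_distrib, Pi.sub_apply, Pi.smul_apply, smul_eq_mul, hv, Finset.mul_sum, Matrix.mulVec_mulVec, sub_eq_add_neg,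
    ← Finset.sum_neg_distrib]
  congr 1
  all_goals first | rfl | (simp only [Matrix.mulVec, dotProduct]; done) | exact Finset.sum_congr rfl fun k _ => by ring

/-- Backward Duhamel solution: `u⁻(1) = 0`. -/
theorem duhamelBwd_one (C : Matrix (Fin 3) (Fin 3) ℝ) (ψ : ℝ → ℝ) (v : Fin 3 → ℝ) :
    ((NormedSpace.exp ((1:ℝ) • C)) *ᵥ fun k => ∫ r in (1:ℝ)..1, ψ r * ((NormedSpace.exp (-(r • C))) *ᵥ v) k) = 0 := by
  have : (fun k => ∫ r in (1:ℝ)..1, ψ r * ((NormedSpace.exp (-(r • C))) *ᵥ v) k) = 0 := by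
    funext k; simp
  rw [this, Matrix.mulVec_zero]

/-- **Backward Duhamel solution: the kernel form of its pairings** `y·u⁻(s) = ∫ₛ¹ ψ(r)·(y·e^{−(r−s)C}v) dr`. [folklore] -/
theorem dotProduct_duhamelBwd (C : Matrix (Fin 3) (Fin 3) ℝ) {ψ : ℝ → ℝ} (hψ : Continuous ψ) (v y : Fin 3 → ℝ) (s : ℝ) :
    y ⬝ᵥ ((NormedSpace.exp (s • C)) *ᵥ fun k => ∫ r in s..(1:ℝ), ψ r * ((NormedSpace.exp (-(r • C))) *ᵥ v) k) =
      ∫ r in s..(1:ℝ), ψ r * (y ⬝ᵥ ((NormedSpace.exp (-((r - s) • C))) *ᵥ v)) := by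
  have hcont : ∀ k, Continuous fun r : ℝ => ψ r * ((NormedSpace.exp (-(r • C))) *ᵥ v) k := fun k =>
    hψ.mul ((continuous_apply k).comp (continuous_exp_neg_smul_mulVec C v))
  have hker : ∀ r : ℝ, ψ r * (y ⬝ᵥ ((NormedSpace.exp (-((r - s) • C))) *ᵥ v)) =
      ∑ i, ∑ k, (y i * (NormedSpace.exp (s • C)) i k) * (ψ r * ((NormedSpace.exp (-(r • C))) *ᵥ v) k) := by
    intro r
    rw [← exp_smul_mul_exp_neg_smul C s r, ← Matrix.mulVec_mulVec]
    simp only [dotProduct, Matrix.mulVec, Finset.mul_sum]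
    refine Finset.sum_congr rfl fun i _ => Finset.sum_congr rfl fun k _ => Finset.sum_congr rfl fun x _ => ?_
    ring
  simp_rw [hker]
  rw [integral_sum_sum_const_mul hcont]
  simp only [dotProduct, Matrix.mulVec, Finset.mul_sum]
  refine Finset.sum_congr rfl fun i _ => Finset.sum_congr rfl fun k _ => ?_
  ring

/-- **Transposed pairing of the semigroup**: `y·(e^{−tC}v) = v·(e^{−tCᵀ}y)` (`Matrix.exp_transpose`). [folklore] -/
theorem dotProduct_exp_neg_smul_mulVec_transpose (C : Matrix (Fin 3) (Fin 3) ℝ) (t : ℝ) (y v : Fin 3 → ℝ) :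
    y ⬝ᵥ ((NormedSpace.exp (-(t • C))) *ᵥ v) = v ⬝ᵥ ((NormedSpace.exp (-(t • Cᵀ))) *ᵥ y) := by
  have ht : -(t • Cᵀ) = (-(t • C))ᵀ := by rw [Matrix.transpose_neg, Matrix.transpose_smul]
  rw [ht, Matrix.exp_transpose, Matrix.mulVec_transpose, dotProduct_comm v, Matrix.dotProduct_mulVec]

end Backward

end Summit.AnomalousDissipation.AnomalousDissipation.Theorems.SolenoidalFractalHomogenisation.LagrangianStep.OddGain

end
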